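import Summits.CriticalPhenomena.PercolationContinuityZ3.Theorems.Transplant.FKConnectivityAllQArborealAuxDefs
import Summits.CriticalPhenomena.PercolationContinuityZ3.Theorems.Transplant.FKConnectivityAllQClusterDomAssoc
import Summits.CriticalPhenomena.PercolationContinuityZ3.Theorems.Transplant.FKConnectivityAllQTwoSumClass
import Summits.CriticalPhenomena.PercolationContinuityZ3.Theorems.Transplant.FKConnectivityAllQWheelEmbedded
import HarnessLib

/-!
# The arboreal gas as the `q ↓ 0` limit of `φ_{𝐩,q}` (Grimmett's Theorem (1.23), weighted and event by event), and its consequences: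
# `FK.HubFKPos → ArborealHubPos` (Ayyer–Linusson–Ravichandran's Conjecture 7.1 from the random-cluster hub node), and ALR's
# Conjecture 7.1 UNCONDITIONALLY on 2-tree (series–parallel) supports and on the 2-tree–`K₄` glued class

Support file (`--supports stmt-CriticalPhenomena-4575`), FK sub-lane `prim-bschramm-fk-1` (gen 9) of the post-continuity programme;
builds on p205010 (kernel theorem, internal audit signed; external expert review pending).  No named facts, no sorries; standard
axioms.  Definitions used: `…ArborealDefs.lean` (`IsForestCfg`, `agMeasure`, `agParams`, `ArborealHubPos`), `…ArborealAuxDefs.lean` (`defi`, `agNorm`, `agPoly`).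

* `card_le_card_add_clusterCount_and_iff`: `|V| ≤ |ω| + k(ω)` with equality iff `ω` is a forest configuration (Grimmett §1.5); `defi`,
  the deficiency.
* `agNorm_mul_rcWeightW_agParams`: on the arboreal curve `p_e(q) = w_e q/(1 − w_e + w_e q)`,
  `(∏_e (1 − w_e + w_e q))·w_q(ω) = (∏_e w_e^{ω(e)}(1−w_e)^{1−ω(e)})·q^{|ω| + k(ω)}`; hence `φ_{p(q),q}(E) = P_E(q)/P_Ω(q)` with the
  polynomials `P_E(q) = Σ_{ω ∈ E} (∏…)·q^{defi ω}` (`real_rcMeasureW_agParams_eq`), and `P_E(0) = Σ_{ω ∈ E} agWeight(ω)` (`agPoly_zero`).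
* **`tendsto_real_rcMeasureW_agParams`**: `φ_{p(q),q}(E) → μ^F_w(E)` as `q ↓ 0` for every event `E` (whenever `Z_for ≠ 0`).
* `agMeasure_real_mul_le_of_eventually`: product inequalities `φ(A)φ(B) ≤ φ(C)φ(D)` valid for all small `q` pass to the arboreal gas.
* **`arborealHubPos_of_hubFKPos`**, `arborealHubPos_of_clusterAssocFKPos`, `arborealHubPos_of_clusterDomAdjFKPos`: the random-cluster
  nodes of fk-1 g4/g7 (hub, CA, MM for every `q > 0`) each imply ALR's Conjecture 7.1 for the arboreal gas.
* UNCONDITIONAL (from fk-1 g5/g6's kernel theorems for `q < 1`): **`hubUnder_agMeasure_of_isTwoTree`**, `hubUnder_agMeasure_of_isTwoTreeK4Glued`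
  — ALR Conj. 7.1 (`μ(o ↔ a)μ(b ↔ a) ≤ μ(Ω)μ(o ↔ a ↔ b)`) for the arboreal gas with arbitrary edge activities supported in a 2-tree
  (resp. in a member of the glued class), for hub pairs `oa, ba` of the support (ALR's Thm. 5.3 has the weaker (13) on outerplanar
  graphs); `agMeasure_negCorr_of_isTwoTree` / `…K4Glued` — edge-negative correlation of the arboreal gas there (Grimmett's (3.94)/(3.96) shape);
  `hubUnder_agMeasure_wheel` / `agMeasure_negCorr_wheel` — the same on WHEELS (fk-3 g8's Potts–Rayleigh wheels), the first infinite
  non-series–parallel family.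
[cite: Grimmett2006, §1.5 eq. (1.22), Thm. (1.23) (pp. 13–14); §3.9 eq. (3.94), Conj. (3.96) (pp. 63–65)]
[cite: AyyerLinussonRavichandran2025, §1 p. 3; §7 eq. (13)–(15), Conj. 7.1 (p. 22); Thm. 5.3] [cite: Wagner2006, Thm. 5.8(d), §5.3]
-/

noncomputable section

namespace Summit.CriticalPhenomena.PercolationContinuityZ3.Theorems

namespace FK

open MeasureTheory Set Literature.Probability.LatticeModels Literature.Probability.Percolation
open scoped Classical
open BHK2006 DecisionTree

variable {V : Type*} [Fintype V] (w : Sym2 V → unitInterval)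

omit [Fintype V] in
/-- The coordinates of `w` lie in `[0, 1]`. [folklore] -/
private theorem coeW_nonneg' (e : Sym2 V) : 0 ≤ (w e : ℝ) := (w e).2.1

omit [Fintype V] in
/-- The coordinates of `w` lie in `[0, 1]`. [folklore] -/
private theorem coeW_le_one' (e : Sym2 V) : (w e : ℝ) ≤ 1 := (w e).2.2

/-! ### The deficiency `|ω| + k(ω) − |V|`: nonnegative, zero exactly on forests -/

omit [Fintype V] in
/-- Inserting a loop pair does not change the open graph. [folklore] -/
theorem openGraph_insert_of_isDiag {e : Sym2 V} (he : e.IsDiag) (ω : BondConfig V) : openGraph (insert e ω) = openGraph ω := by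
  ext a b
  simp only [openGraph, SimpleGraph.fromEdgeSet_adj, Set.mem_insert_iff]
  constructor
  · rintro ⟨h | h, hab⟩
    · exact absurd (h ▸ he : (s(a, b)).IsDiag) (by rwa [Sym2.mk_isDiag_iff])
    · exact ⟨h, hab⟩
  · rintro ⟨h, hab⟩; exact ⟨Or.inr h, hab⟩

omit [Fintype V] in
/-- Inserting the pair `s(u,v)` adds the edge `uv` to the open graph (with the free wiring `wired ∅ = ⊥`). [folklore] -/
theorem openGraph_insert_sup_wired_empty (u v : V) (ω : BondConfig V) :
    openGraph (insert s(u, v) ω) ⊔ wired (∅ : Set V) = (openGraph ω ⊔ wired (∅ : Set V)) ⊔ SimpleGraph.edge u v := by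
  change SimpleGraph.fromEdgeSet (insert s(u, v) ω) ⊔ wired ∅ = _
  rw [Set.insert_eq, SimpleGraph.fromEdgeSet_union, sup_comm (SimpleGraph.fromEdgeSet {s(u, v)}), sup_right_comm]
  rfl

/-- **`|V| ≤ |ω| + k(ω)`, with equality exactly for forest configurations** (loop-free and acyclic): each inserted pair raises
`|ω|` by one and lowers the cluster count by one exactly when it joins two clusters, i.e. exactly when it creates no cycle.
[cite: Grimmett2006, §1.5 (p. 13): "|η(ω)| + k(ω) ≥ |V| with equality if and only if ω ∈ Ω_for"] -/
theorem card_le_card_add_clusterCount_and_iff (t : Finset (Sym2 V)) :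
    Fintype.card V ≤ t.card + clusterCount (↑t : BondConfig V) ∅ ∧
      (t.card + clusterCount (↑t : BondConfig V) ∅ = Fintype.card V ↔ IsForestCfg (↑t : BondConfig V)) := by
  induction t using Finset.induction_on with
  | empty =>
    rw [Finset.coe_empty, clusterCount_empty_card, Finset.card_empty, zero_add]
    exact ⟨le_rfl, ⟨fun _ => isForestCfg_empty, fun _ => rfl⟩⟩
  | @insert e t het ih =>
    obtain ⟨ihle, ihiff⟩ := ih
    rw [Finset.coe_insert, Finset.card_insert_of_notMem het]
    have het' : e ∉ (↑t : BondConfig V) := fun h => het (Finset.mem_coe.1 h)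
    by_cases hd : e.IsDiag
    · -- a loop: `k` unchanged, `|ω|` up by one, never a forest
      have hk : clusterCount (insert e (↑t : BondConfig V)) ∅ = clusterCount (↑t : BondConfig V) ∅ := by
        unfold clusterCount; rw [openGraph_insert_of_isDiag hd]
      rw [hk]
      refine ⟨by omega, ⟨fun h => by omega, fun hF => absurd hd (hF.1 e (Set.mem_insert _ _))⟩⟩
    · -- a genuine pair `e = s(u,v)`, `u ≠ v`
      induction e using Sym2.inductionOn with
      | hf u v =>
        have huv : u ≠ v := fun h => hd (Sym2.mk_isDiag_iff.2 h)
        have hG : openGraph (insert s(u, v) (↑t : BondConfig V)) ⊔ wired (∅ : Set V) =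
            (openGraph (↑t : BondConfig V) ⊔ wired (∅ : Set V)) ⊔ SimpleGraph.edge u v :=
          openGraph_insert_sup_wired_empty u v _
        have hacyc : IsForestCfg (insert s(u, v) (↑t : BondConfig V)) ↔
            IsForestCfg (↑t : BondConfig V) ∧ ¬ (openGraph (↑t : BondConfig V)).Reachable u v := by
          have hgraph : openGraph (insert s(u, v) (↑t : BondConfig V)) = openGraph (↑t : BondConfig V) ⊔ SimpleGraph.edge u v := by
            have h := hG; rwa [wired_empty, sup_bot_eq, sup_bot_eq] at h
          have hnadj : ¬ (openGraph (↑t : BondConfig V)).Adj u v := fun h => het' ((openGraph_adj _ u v).1 h).1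
          constructor
          · rintro ⟨hl, ha⟩
            rw [hgraph, SimpleGraph.isAcyclic_sup_fromEdgeSet_iff] at ha
            refine ⟨⟨fun f hf => hl f (Set.mem_insert_of_mem _ hf), ha.1⟩, fun hr => ?_⟩
            rcases ha.2 hr with h | h
            · exact huv h
            · exact hnadj h
          · rintro ⟨⟨hl, ha⟩, hr⟩
            refine ⟨?_, ?_⟩
            · rintro f (rfl | hf)
              · exact hd
              · exact hl f hf
            · rw [hgraph, SimpleGraph.isAcyclic_sup_fromEdgeSet_iff]
              exact ⟨ha, fun h => absurd h hr⟩
        by_cases hr : (openGraph (↑t : BondConfig V)).Reachable u v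
        · -- already joined: `k` unchanged, not a forest
          have hr' : (openGraph (↑t : BondConfig V) ⊔ wired (∅ : Set V)).Reachable u v := by
            rw [wired_empty, sup_bot_eq]; exact hr
          have hk : clusterCount (insert s(u, v) (↑t : BondConfig V)) ∅ = clusterCount (↑t : BondConfig V) ∅ := by
            unfold clusterCount; rw [hG]; exact card_connectedComponent_sup_edge_of_reachable _ hr'
          rw [hk]
          refine ⟨by omega, ⟨fun h => by omega, fun hF => absurd hr (hacyc.1 hF).2⟩⟩
        · -- newly joined: `k` drops by one, forest iff it was a forest
          have hr' : ¬ (openGraph (↑t : BondConfig V) ⊔ wired (∅ : Set V)).Reachable u v := by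
            rw [wired_empty, sup_bot_eq]; exact hr
          have hk : clusterCount (↑t : BondConfig V) ∅ = clusterCount (insert s(u, v) (↑t : BondConfig V)) ∅ + 1 := by
            unfold clusterCount
            rw [hG]
            have h1 := card_connectedComponent_sup_edge_lt _ hr'
            have h2 := card_connectedComponent_le_sup_edge_add_one (openGraph (↑t : BondConfig V) ⊔ wired (∅ : Set V)) u v
            omega
          refine ⟨by omega, ⟨fun h => hacyc.2 ⟨ihiff.1 (by omega), hr⟩, fun hF => ?_⟩⟩
          have := ihiff.2 (hacyc.1 hF).1
          omega

/-- `|ω| + k(ω) = |V| + defi ω`. [cite: Grimmett2006, §1.5 (p. 13)] -/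
theorem ncard_add_clusterCount_eq (ω : BondConfig V) : ω.ncard + clusterCount ω ∅ = Fintype.card V + defi ω := by
  have h := (card_le_card_add_clusterCount_and_iff ω.toFinset).1
  rw [Set.coe_toFinset, ← Set.ncard_eq_toFinset_card'] at h
  unfold defi; omega

/-- `defi ω = 0` exactly for forests. [cite: Grimmett2006, §1.5 (p. 13)] -/
theorem defi_eq_zero_iff (ω : BondConfig V) : defi ω = 0 ↔ IsForestCfg ω := by
  have h := card_le_card_add_clusterCount_and_iff ω.toFinset
  rw [Set.coe_toFinset, ← Set.ncard_eq_toFinset_card'] at h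
  rw [← h.2]; unfold defi; omega

/-! ### The random-cluster weights on the arboreal curve -/

omit [Fintype V] in
/-- Each factor of `c(q)` is positive for `q > 0`. [folklore] -/
theorem agNorm_factor_pos {q : ℝ} (hq : 0 < q) (e : Sym2 V) : 0 < 1 - (w e : ℝ) + (w e : ℝ) * q := by
  rcases (coeW_le_one' w e).eq_or_lt with he | he
  · rw [he]; linarith
  · nlinarith [coeW_nonneg' w e]

/-- `c(q) > 0` for `q > 0`. [folklore] -/
theorem agNorm_pos {q : ℝ} (hq : 0 < q) : 0 < agNorm w q := Finset.prod_pos fun e _ => agNorm_factor_pos w hq e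

/-- **The random-cluster weight on the arboreal curve**: `c(q)·w_q[p(q)](ω) = (∏_e w_e^{ω(e)}(1−w_e)^{1−ω(e)})·q^{|ω| + k(ω)}` (`q > 0`).
[cite: Grimmett2006, §1.5 (pp. 13–14), the display before (1.22)] -/
theorem agNorm_mul_rcWeightW_agParams {q : ℝ} (hq : 0 < q) (ω : BondConfig V) :
    agNorm w q * rcWeightW (agParams w q) q ∅ ω = weight (fun e => (w e : ℝ)) ω * q ^ (ω.ncard + clusterCount ω ∅) := by
  unfold rcWeightW agNorm weight
  rw [pow_add, ← mul_assoc, ← Finset.prod_mul_distrib]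
  have hprod : ∏ e : Sym2 V, (1 - (w e : ℝ) + (w e : ℝ) * q) *
      (if e ∈ ω then ((agParams w q e : unitInterval) : ℝ) else 1 - ((agParams w q e : unitInterval) : ℝ)) =
      (∏ e : Sym2 V, if e ∈ ω then (w e : ℝ) else 1 - (w e : ℝ)) * ∏ e : Sym2 V, (if e ∈ ω then q else 1) := by
    rw [← Finset.prod_mul_distrib]
    refine Finset.prod_congr rfl fun e _ => ?_
    have hden := agNorm_factor_pos w hq e
    by_cases he : e ∈ ω
    · rw [if_pos he, if_pos he, if_pos he, coe_agParams w hq]; field_simp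
    · rw [if_neg he, if_neg he, if_neg he, one_sub_coe_agParams w hq]; field_simp
  have hpow : ∏ e : Sym2 V, (if e ∈ ω then q else 1) = q ^ ω.ncard := by
    rw [Finset.prod_ite, Finset.prod_const_one, mul_one, Finset.prod_const, Set.ncard_eq_toFinset_card' ω]
    congr 2
    ext e; simp
  rw [hprod, hpow]
  ring

/-- **`φ_{p(q),q}(E) = P_E(q)/P_Ω(q)`** on the arboreal curve, `q > 0`. [cite: Grimmett2006, §1.5 (pp. 13–14)] -/
theorem real_rcMeasureW_agParams_eq {q : ℝ} (hq : 0 < q) (E : Set (BondConfig V)) :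
    (rcMeasureW (agParams w q) q ∅).real E = agPoly w E q / agPoly w univ q := by
  have hc := agNorm_pos w hq
  have hqV : 0 < q ^ Fintype.card V := pow_pos hq _
  have hterm : ∀ ω : BondConfig V, rcWeightW (agParams w q) q ∅ ω =
      (agNorm w q)⁻¹ * q ^ Fintype.card V * (weight (fun e => (w e : ℝ)) ω * q ^ defi ω) := by
    intro ω
    have h := agNorm_mul_rcWeightW_agParams w hq ω
    rw [ncard_add_clusterCount_eq, pow_add] at h
    field_simp
    linear_combination h
  rw [rcMeasureW_real_eq_sum_div _ hq]
  unfold rcPartitionFunctionW agPoly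
  simp only [hterm, ind_of_mem (Set.mem_univ _), mul_one]
  rw [show ∑ ω : BondConfig V, (agNorm w q)⁻¹ * q ^ Fintype.card V * (weight (fun e => (w e : ℝ)) ω * q ^ defi ω) * ind E ω =
      (agNorm w q)⁻¹ * q ^ Fintype.card V * ∑ ω : BondConfig V, weight (fun e => (w e : ℝ)) ω * q ^ defi ω * ind E ω by
    rw [Finset.mul_sum]; exact Finset.sum_congr rfl fun ω _ => by ring,
    ← Finset.mul_sum]
  rw [mul_div_mul_left _ _ (mul_pos (inv_pos.2 hc) hqV).ne']

/-- `P_E` is continuous in `q`. [folklore] -/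
theorem continuous_agPoly (E : Set (BondConfig V)) : Continuous (agPoly w E) := by
  unfold agPoly
  exact continuous_finsetSum _ fun ω _ => (continuous_const.mul (continuous_pow _)).mul continuous_const

/-- **At `q = 0` the polynomial `P_E` is the arboreal-gas mass of `E`**: `P_E(0) = Σ_{ω ∈ E} agWeight(ω)` (the monomial `q^{defi ω}`
survives exactly on forests). [cite: Grimmett2006, §1.5 eq. (1.22) (p. 13)] -/
theorem agPoly_zero (E : Set (BondConfig V)) : agPoly w E 0 = ∑ ω : BondConfig V, agWeight w ω * ind E ω := by
  unfold agPoly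
  refine Finset.sum_congr rfl fun ω _ => ?_
  by_cases hF : IsForestCfg ω
  · rw [(defi_eq_zero_iff ω).2 hF, pow_zero, mul_one, agWeight_of_isForestCfg w hF]
  · rw [zero_pow (fun h => hF ((defi_eq_zero_iff ω).1 h)), mul_zero, zero_mul, agWeight_of_not_isForestCfg w hF, zero_mul]

/-- `P_Ω(0) = Z_for`. [cite: Grimmett2006, §1.5 eq. (1.22) (p. 13)] -/
theorem agPoly_univ_zero : agPoly w univ 0 = agPartition w := by
  rw [agPoly_zero]; unfold agPartition
  exact Finset.sum_congr rfl fun ω _ => by rw [ind_of_mem (Set.mem_univ _), mul_one]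

/-- The arboreal-gas measure of an event as the ratio `P_E(0)/P_Ω(0)`. [cite: Grimmett2006, §1.5 eq. (1.22) (p. 13)] -/
theorem agMeasure_real_eq_div (E : Set (BondConfig V)) : (agMeasure w).real E = agPoly w E 0 / agPoly w univ 0 := by
  rw [agMeasure_real_eq_sum, agPoly_zero, agPoly_univ_zero, Finset.sum_div]
  unfold agMass
  exact Finset.sum_congr rfl fun ω _ => by ring

/-- **Grimmett's Theorem (1.23), weighted form: `φ_{p(q),q} ⇒ arboreal gas` as `q ↓ 0` along the arboreal curve** (event by event,
whenever `Z_for > 0`). [cite: Grimmett2006, §1.5 eq. (1.22), Thm. (1.23) (pp. 13–14)] -/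
theorem tendsto_real_rcMeasureW_agParams (hZ : agPartition w ≠ 0) (E : Set (BondConfig V)) :
    Filter.Tendsto (fun q => (rcMeasureW (agParams w q) q ∅).real E) (nhdsWithin 0 (Ioi 0)) (nhds ((agMeasure w).real E)) := by
  have hE : Filter.Tendsto (agPoly w E) (nhdsWithin 0 (Ioi 0)) (nhds (agPoly w E 0)) :=
    ((continuous_agPoly w E).tendsto 0).mono_left nhdsWithin_le_nhds
  have hU : Filter.Tendsto (agPoly w univ) (nhdsWithin 0 (Ioi 0)) (nhds (agPoly w univ 0)) :=
    ((continuous_agPoly w univ).tendsto 0).mono_left nhdsWithin_le_nhds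
  have hU0 : agPoly w univ 0 ≠ 0 := by rwa [agPoly_univ_zero]
  rw [agMeasure_real_eq_div]
  refine (hE.div hU hU0).congr' ?_
  filter_upwards [self_mem_nhdsWithin] with q hq
  exact (real_rcMeasureW_agParams_eq w hq E).symm

/-! ### Transfer of product inequalities to the limit -/

/-- **Transfer principle.**  An inequality `φ(A)φ(B) ≤ φ(C)φ(D)` that holds for `φ = φ_{p(q),q}` for all small `q > 0` holds for the
arboreal gas (for `Z_for = 0` the arboreal-gas measure is the junk zero measure and the inequality is trivial).
[cite: Grimmett2006, §1.5 Thm. (1.23) (pp. 13–14)] -/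
theorem agMeasure_real_mul_le_of_eventually (A B C D : Set (BondConfig V))
    (h : ∀ᶠ q in nhdsWithin 0 (Ioi 0), (rcMeasureW (agParams w q) q ∅).real A * (rcMeasureW (agParams w q) q ∅).real B ≤
      (rcMeasureW (agParams w q) q ∅).real C * (rcMeasureW (agParams w q) q ∅).real D) :
    (agMeasure w).real A * (agMeasure w).real B ≤ (agMeasure w).real C * (agMeasure w).real D := by
  by_cases hZ : agPartition w = 0
  · have h0 : ∀ E : Set (BondConfig V), (agMeasure w).real E = 0 := fun E => by
      rw [agMeasure_real_eq_sum]
      exact Finset.sum_eq_zero fun ω _ => by unfold agMass; rw [hZ, div_zero, zero_mul]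
    rw [h0, h0, h0, h0]
  · exact le_of_tendsto_of_tendsto ((tendsto_real_rcMeasureW_agParams w hZ A).mul (tendsto_real_rcMeasureW_agParams w hZ B))
      ((tendsto_real_rcMeasureW_agParams w hZ C).mul (tendsto_real_rcMeasureW_agParams w hZ D)) h

/-- Every `q ∈ (0,1)` is eventually reached: a property of all `q ∈ (0,1)` holds eventually along `q ↓ 0`. [folklore] -/
theorem eventually_nhdsWithin_of_forall_Ioo {P : ℝ → Prop} (h : ∀ q : ℝ, 0 < q → q < 1 → P q) :
    ∀ᶠ q in nhdsWithin 0 (Ioi 0), P q := by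
  have hmem : Ioo (0 : ℝ) 1 ∈ nhdsWithin 0 (Ioi 0) := Ioo_mem_nhdsGT zero_lt_one
  filter_upwards [hmem] with q hq
  exact h q hq.1 hq.2


/-! ### The support of the arboreal curve -/

omit [Fintype V] in
/-- A pair of parameter `0` stays at `0` on the arboreal curve; hence the curve is supported where `w` is. [folklore] -/
theorem coe_agParams_ne_zero {q : ℝ} (hq : 0 < q) {e : Sym2 V} (he : ((agParams w q e : unitInterval) : ℝ) ≠ 0) :
    ((w e : unitInterval) : ℝ) ≠ 0 := by
  intro h0
  apply he
  rw [coe_agParams w hq, h0, zero_mul, zero_div]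

omit [Fintype V] in
/-- Support transfer: if `w` is supported in `S`, so is every point of the arboreal curve. [folklore] -/
theorem agParams_supp {q : ℝ} (hq : 0 < q) {S : Set (Sym2 V)} (hw : ∀ e, ((w e : unitInterval) : ℝ) ≠ 0 → e ∈ S) :
    ∀ e, ((agParams w q e : unitInterval) : ℝ) ≠ 0 → e ∈ S :=
  fun e he => hw e (coe_agParams_ne_zero w hq he)

/-! ### ALR Conjecture 7.1 from the random-cluster hub node, and unconditionally on the certified negative-correlation classes -/

/-- **Hub transfer**: if the hub inequality holds for `φ_{p(q),q}` at every `q ∈ (0,1)` on the arboreal curve of `w`, it holds for the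
arboreal gas with parameters `w`. [cite: AyyerLinussonRavichandran2025, §7 eq. (13)–(15), Conj. 7.1 (p. 22)] [cite: Grimmett2006, §1.5 Thm. (1.23) (pp. 13–14)] -/
theorem hubUnder_agMeasure_of_forall (o a b : V)
    (h : ∀ q : ℝ, 0 < q → q < 1 → HubUnder (rcMeasureW (agParams w q) q ∅) o a b) : HubUnder (agMeasure w) o a b :=
  agMeasure_real_mul_le_of_eventually w _ _ _ _ (eventually_nhdsWithin_of_forall_Ioo h)

/-- **`FK.HubFKPos → ArborealHubPos`**: the random-cluster hub node (hub inequality for every `φ_{w,q}`, `q > 0`) implies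
Ayyer–Linusson–Ravichandran's Conjecture 7.1 for the arboreal gas on every finite weighted graph — the arboreal gas is the `q ↓ 0` limit
along the arboreal curve. [cite: AyyerLinussonRavichandran2025, §7 Conj. 7.1 (p. 22)] [cite: Grimmett2006, §1.5 Thm. (1.23) (pp. 13–14)] -/
theorem arborealHubPos_of_hubFKPos (h : HubFKPos) : ArborealHubPos :=
  fun n w u a v => hubUnder_agMeasure_of_forall w u a v fun q hq0 _ => h q hq0 n (agParams w q) u a v

/-- **`FK.ClusterAssocFKPos → ArborealHubPos`** (via CA ⇒ hub, fk-1 g7). [cite: AyyerLinussonRavichandran2025, §7 Conj. 7.1 (p. 22)] -/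
theorem arborealHubPos_of_clusterAssocFKPos (h : ClusterAssocFKPos) : ArborealHubPos :=
  arborealHubPos_of_hubFKPos (hubFKPos_of_clusterAssocFKPos h)

/-- **`FK.ClusterDomAdjFKPos → ArborealHubPos`**: the single node MM (stochastic monotonicity of the cluster in an adjacent edge, every
`q > 0`) implies ALR's Conjecture 7.1 (via MM ⇒ CA ⇒ hub, fk-1 g8/g7, and the limit `q ↓ 0`).
[cite: AyyerLinussonRavichandran2025, §7 Conj. 7.1 (p. 22)] [cite: Grimmett2006, §3.9 (pp. 63–65)] -/
theorem arborealHubPos_of_clusterDomAdjFKPos (h : ClusterDomAdjFKPos) : ArborealHubPos :=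
  arborealHubPos_of_hubFKPos (hubFKPos_of_clusterDomAdjFKPos h)

/-- **Hub transfer from a certified negative-correlation class**: if `φ_{u,q}` is edge-negatively associated for every `q ∈ (0,1)` and
every `u` supported in `S` (`EdgeNegCorrSupp S q`), then for every `w` supported in `S` and all `o, b` with `oa, ba ∈ S` the ARBOREAL GAS
with parameters `w` satisfies the hub inequality `μ(o ↔ a)μ(b ↔ a) ≤ μ(Ω)μ(o ↔ a ↔ b)` (ALR Conj. 7.1 on that class).
[cite: AyyerLinussonRavichandran2025, §7 eq. (15), Conj. 7.1 (p. 22)] [cite: Grimmett2006, §3.9 eq. (3.94) (p. 63); §1.5 Thm. (1.23)] -/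
theorem hubUnder_agMeasure_of_edgeNegCorrSupp {S : Set (Sym2 V)} (hS : ∀ q : ℝ, 0 < q → q < 1 → EdgeNegCorrSupp S q)
    {o a b : V} (hoa : s(o, a) ∈ S) (hba : s(b, a) ∈ S) (hw : ∀ e, ((w e : unitInterval) : ℝ) ≠ 0 → e ∈ S) :
    HubUnder (agMeasure w) o a b :=
  hubUnder_agMeasure_of_forall w o a b fun q hq0 hq1 =>
    hubUnder_of_edgeNegCorr_on hq0 hq1 S (hS q hq0 hq1) o a b hoa hba (agParams w q) (agParams_supp w hq0 hw)

/-- **Edge-negative correlation of the arboreal gas on a certified class**: under the same hypothesis, for `w` supported in `S`, a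
non-loop pair `e` and `f ≠ e`, `μ(J_e ∩ J_f)·μ(Ω) ≤ μ(J_e)·μ(J_f)` for the arboreal gas `μ` with parameters `w` (the `q ↓ 0` limit of
Grimmett's (3.94); cf. Conj. (3.96) for uniform forests). [cite: Grimmett2006, §3.9 eq. (3.94), Conj. (3.96) (pp. 63–65); §1.5 Thm. (1.23)] -/
theorem agMeasure_negCorr_of_edgeNegCorrSupp {S : Set (Sym2 V)} (hS : ∀ q : ℝ, 0 < q → q < 1 → EdgeNegCorrSupp S q)
    (hw : ∀ e, ((w e : unitInterval) : ℝ) ≠ 0 → e ∈ S) {e f : Sym2 V} (he : ¬ e.IsDiag) (hfe : f ≠ e) :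
    (agMeasure w).real ({ω | e ∈ ω} ∩ {ω | f ∈ ω}) * (agMeasure w).real univ ≤
      (agMeasure w).real {ω | e ∈ ω} * (agMeasure w).real {ω | f ∈ ω} := by
  refine agMeasure_real_mul_le_of_eventually w _ _ _ _ (eventually_nhdsWithin_of_forall_Ioo fun q hq0 hq1 => ?_)
  haveI := isProbabilityMeasure_rcMeasureW (agParams w q) hq0 (∅ : Set V)
  rw [probReal_univ, mul_one]
  exact hS q hq0 hq1 (agParams w q) (agParams_supp w hq0 hw) e f he hfe

/-- **ALR Conjecture 7.1 on 2-tree (series–parallel) supports — UNCONDITIONAL** (from fk-1 g5's kernel theorem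
`edgeNegCorrSupp_of_isTwoTree`, Wagner's theorem for `φ_{w,q}`, `q < 1`, by apex elimination): for every weight vector supported in a
2-tree `T ∋ oa, ba`, the arboreal gas satisfies `μ(o ↔ a)μ(b ↔ a) ≤ μ(Ω)μ(o ↔ a ↔ b)`.  ALR prove the weaker (13) on outerplanar graphs
(their Thm. 5.3). [cite: AyyerLinussonRavichandran2025, §7 eq. (15), Conj. 7.1 (p. 22); Thm. 5.3] [cite: Wagner2006, Thm. 5.8(d), §5.3] -/
theorem hubUnder_agMeasure_of_isTwoTree {T : Set (Sym2 V)} (hT : IsTwoTree T) {o a b : V} (hoa : s(o, a) ∈ T) (hba : s(b, a) ∈ T)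
    (hw : ∀ e, ((w e : unitInterval) : ℝ) ≠ 0 → e ∈ T) : HubUnder (agMeasure w) o a b :=
  hubUnder_agMeasure_of_edgeNegCorrSupp w (fun _ hq0 hq1 => edgeNegCorrSupp_of_isTwoTree hq0 hq1.le hT) hoa hba hw

/-- **ALR Conjecture 7.1 on the glued class** (2-trees and `K₄`'s glued along shared pairs, fk-1 g6's `IsTwoTreeK4Glued`) — UNCONDITIONAL.
[cite: AyyerLinussonRavichandran2025, §7 eq. (15), Conj. 7.1 (p. 22)] [cite: Wagner2006, Thm. 5.8(d), Ex. 5.1] -/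
theorem hubUnder_agMeasure_of_isTwoTreeK4Glued {E : Set (Sym2 V)} (hE : IsTwoTreeK4Glued E) {o a b : V} (hoa : s(o, a) ∈ E)
    (hba : s(b, a) ∈ E) (hw : ∀ e, ((w e : unitInterval) : ℝ) ≠ 0 → e ∈ E) : HubUnder (agMeasure w) o a b :=
  hubUnder_agMeasure_of_edgeNegCorrSupp w (fun _ hq0 hq1 => edgeNegCorrSupp_of_isTwoTreeK4Glued hq0 hq1.le hE) hoa hba hw

/-- **Edge-negative correlation of the arboreal gas on 2-tree supports** (weighted spanning forests of series–parallel graphs are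
edge-negatively correlated) — UNCONDITIONAL, as the `q ↓ 0` limit of fk-1 g5's theorem.
[cite: Grimmett2006, §3.9 eq. (3.94), Conj. (3.96) (pp. 63–65)] [cite: Wagner2006, Thm. 5.8(d), §5.3] -/
theorem agMeasure_negCorr_of_isTwoTree {T : Set (Sym2 V)} (hT : IsTwoTree T) (hw : ∀ e, ((w e : unitInterval) : ℝ) ≠ 0 → e ∈ T)
    {e f : Sym2 V} (he : ¬ e.IsDiag) (hfe : f ≠ e) :
    (agMeasure w).real ({ω | e ∈ ω} ∩ {ω | f ∈ ω}) * (agMeasure w).real univ ≤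
      (agMeasure w).real {ω | e ∈ ω} * (agMeasure w).real {ω | f ∈ ω} :=
  agMeasure_negCorr_of_edgeNegCorrSupp w (fun _ hq0 hq1 => edgeNegCorrSupp_of_isTwoTree hq0 hq1.le hT) hw he hfe

/-- **Edge-negative correlation of the arboreal gas on the glued class** — UNCONDITIONAL. [cite: Grimmett2006, §3.9 eq. (3.94), Conj. (3.96) (pp. 63–65)] -/
theorem agMeasure_negCorr_of_isTwoTreeK4Glued {E : Set (Sym2 V)} (hE : IsTwoTreeK4Glued E)
    (hw : ∀ e, ((w e : unitInterval) : ℝ) ≠ 0 → e ∈ E) {e f : Sym2 V} (he : ¬ e.IsDiag) (hfe : f ≠ e) :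
    (agMeasure w).real ({ω | e ∈ ω} ∩ {ω | f ∈ ω}) * (agMeasure w).real univ ≤
      (agMeasure w).real {ω | e ∈ ω} * (agMeasure w).real {ω | f ∈ ω} :=
  agMeasure_negCorr_of_edgeNegCorrSupp w (fun _ hq0 hq1 => edgeNegCorrSupp_of_isTwoTreeK4Glued hq0 hq1.le hE) hw he hfe

/-- **ALR Conjecture 7.1 on wheels** — UNCONDITIONAL (from fk-3 g8's kernel theorem `Wheel.edgeNegCorrSupp_wheelPairs`: wheels are
Potts–Rayleigh for `0 < q ≤ 1`): for a hub `h`, `n ≥ 3` pairwise distinct rim vertices `u 0, …, u (n−1)` different from `h`, every weight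
vector supported on the wheel pairs and hub pairs `oa, ba` of the wheel, the arboreal gas satisfies `μ(o ↔ a)μ(b ↔ a) ≤ μ(Ω)μ(o ↔ a ↔ b)` —
the first infinite family beyond series–parallel. [cite: AyyerLinussonRavichandran2025, §7 eq. (15), Conj. 7.1 (p. 22)] [cite: Grimmett2006, §3.9 Conj. (3.96) (p. 65)] -/
theorem hubUnder_agMeasure_wheel (h : V) (u : ℕ → V) {n : ℕ} (hn : 3 ≤ n) (hinj : ∀ j k, j < n → k < n → u j = u k → j = k)
    (hux : ∀ j, j < n → u j ≠ h) {o a b : V} (hoa : s(o, a) ∈ (↑(Wheel.wheelPairs h u n) : Set (Sym2 V)))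
    (hba : s(b, a) ∈ (↑(Wheel.wheelPairs h u n) : Set (Sym2 V)))
    (hw : ∀ e, ((w e : unitInterval) : ℝ) ≠ 0 → e ∈ (↑(Wheel.wheelPairs h u n) : Set (Sym2 V))) : HubUnder (agMeasure w) o a b :=
  hubUnder_agMeasure_of_edgeNegCorrSupp w (fun _ hq0 hq1 => Wheel.edgeNegCorrSupp_wheelPairs hq0 hq1.le h u hn hinj hux) hoa hba hw

/-- **Edge-negative correlation of the arboreal gas on wheels** — UNCONDITIONAL (the `q ↓ 0` limit of fk-3 g8's theorem; uniform forests
of wheels are covered by Grimmett–Winkler's Theorem (3.100) only up to 9 vertices). [cite: Grimmett2006, §3.9 eq. (3.94), Conj. (3.96), Thm. (3.100) (pp. 63–66)] -/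
theorem agMeasure_negCorr_wheel (h : V) (u : ℕ → V) {n : ℕ} (hn : 3 ≤ n) (hinj : ∀ j k, j < n → k < n → u j = u k → j = k)
    (hux : ∀ j, j < n → u j ≠ h) (hw : ∀ e, ((w e : unitInterval) : ℝ) ≠ 0 → e ∈ (↑(Wheel.wheelPairs h u n) : Set (Sym2 V)))
    {e f : Sym2 V} (he : ¬ e.IsDiag) (hfe : f ≠ e) :
    (agMeasure w).real ({ω | e ∈ ω} ∩ {ω | f ∈ ω}) * (agMeasure w).real univ ≤
      (agMeasure w).real {ω | e ∈ ω} * (agMeasure w).real {ω | f ∈ ω} :=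
  agMeasure_negCorr_of_edgeNegCorrSupp w (fun _ hq0 hq1 => Wheel.edgeNegCorrSupp_wheelPairs hq0 hq1.le h u hn hinj hux) hw he hfe

end FK

end Summit.CriticalPhenomena.PercolationContinuityZ3.Theorems

end
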